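import Summits.Ventures.PercRepro.S1CFCapsFour
import Summits.Ventures.PercRepro.S1CFSimpleCaps
import Summits.Ventures.PercRepro.S1CFGThree

/-!
# PercRepro — THE DEPENDENT `4`-SETS OF A LOOPLESS COLOOP-FREE MATROID OF NULLITY `4` ON `n ≥ 11` POINTS: THE CASES
`D₂ ≥ 5`, `D₂ = 4`, `D₂ ≤ 3` (p1, gen 38; stage 1 of the cap `D₄` for every `n`)

The `12`-point theorems of S1CFCapsFour (p1, gen 37) for every ground set of `n ≥ 11` points, with the split
`D₄ ≤ C(n − 2, 2) · D₂ + (n − 3) · c₃ + c₄` of S1CFSimpleCaps (`ncard_dep_four_le_split_general`):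
* **`ncard_dep_four_le_of_five_le`** — `D₂ ≥ 5 ⇒ D₄ ≤ 6 · C(n − 4, 2) + 4 · (n − 4) + 1` (every dependent pair lies in
  one class `F` of `4` points, there are no short circuits (LEMMA K), so every dependent `4`-set meets `F` in `≥ 2`
  points; the value of the extremal `N` = a class of `4` ⊕ `U(n − 5, n − 4)`; at `n = 12`: `201`);
* **`ncard_dep_four_le_of_eq_four`** — `D₂ = 4 ⇒ D₄ ≤ 4 · C(n − 2, 2)` (no short circuits);
* **`ncard_dep_four_le_of_le_three`** — `D₂ ≤ 3 ⇒ D₄ ≤ 3 · C(n − 2, 2) + 20 · (n − 3) + 35` (the nullity-only circuit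
  counts; sharpened in S1CFGFourTwo / S1CFGFourThree).
Nothing about any cell is claimed. Axioms: standard.
-/

open scoped Matroid

namespace PercRepro

namespace S1CFG

open Set S1CF

variable {α : Type}

/-- **`D₂ ≥ 5 ⇒ D₄ ≤ 6 · C(n − 4, 2) + 4 · (n − 4) + 1`** (`n ≥ 11`): the dependent `4`-sets are those meeting the
class of `4` in at least two points. -/
theorem ncard_dep_four_le_of_five_le (M : Matroid α) [M.Finite] (hL : ∀ e ∈ M.E, ¬ M.IsLoop e)
    (hK : ∀ e, ¬ M.IsColoop e) (hd : M.E.encard = M.eRank + ((4 : ℕ) : ℕ∞)) (hn : 11 ≤ M.E.ncard)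
    (h5 : 5 ≤ {P : Set α | P ⊆ M.E ∧ P.ncard = 2 ∧ M.Dep P}.ncard) :
    {X : Set α | X ⊆ M.E ∧ X.ncard = 4 ∧ M.Dep X}.ncard ≤
      6 * (M.E.ncard - 4).choose 2 + 4 * (M.E.ncard - 4) + 1 := by
  classical
  have hEfin := M.ground_finite
  obtain ⟨P₀, hP₀⟩ : {P : Set α | P ⊆ M.E ∧ P.ncard = 2 ∧ M.Dep P}.Nonempty := by
    rw [← Set.ncard_pos (hEfin.finite_subsets.subset (fun P hP => hP.1))]; omega
  obtain ⟨hP₀E, hP₀2, hP₀dep⟩ := hP₀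
  obtain ⟨x, y, hxy, rfl⟩ := Set.ncard_eq_two.1 hP₀2
  have hxE : x ∈ M.E := hP₀E (by simp)
  have hyE : y ∈ M.E := hP₀E (by simp)
  obtain ⟨hF4, hall⟩ := closure_singleton_of_five_dep_pairs M hL hK hd (by omega) h5 hxy hxE hyE hP₀dep
  set F := M.closure {x} with hFdef
  have hF : F ⊆ M.E := M.closure_subset_ground _
  have hEF : (M.E \ F).ncard = M.E.ncard - 4 := by
    have := Set.ncard_sdiff_add_ncard_of_subset hF hEfin
    omega
  -- every dependent 4-set contains a dependent pair (no short circuits), which lies in `F`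
  have hsub : {X : Set α | X ⊆ M.E ∧ X.ncard = 4 ∧ M.Dep X} ⊆
      {X : Set α | X ⊆ M.E ∧ X.ncard = 4 ∧ (X ∩ F).ncard = 2} ∪
        {X : Set α | X ⊆ M.E ∧ X.ncard = 4 ∧ (X ∩ F).ncard = 3} ∪
          {X : Set α | X ⊆ M.E ∧ X.ncard = 4 ∧ (X ∩ F).ncard = 4} := by
    intro X hX
    obtain ⟨hXE, hX4, hXdep⟩ := hX
    have hXfin : X.Finite := hEfin.subset hXE
    have hpair : ∃ P ⊆ X, P.ncard = 2 ∧ M.Dep P := by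
      by_contra h2
      push Not at h2
      have hno3 : ∀ T ⊆ X, M.IsCircuit T → T.ncard = 3 → False := fun T _ hTc hT3 =>
        not_isCircuit_of_four_le_ncard_dep_pairs M hL hK hd hn (by omega) hTc (by omega) (by omega)
      have hc := isCircuit_of_dep_four_of_no_dep_pair_of_no_triangle M hXE hX4 hXdep h2 hno3
      exact not_isCircuit_of_four_le_ncard_dep_pairs M hL hK hd hn (by omega) hc (by omega) (by omega)
    obtain ⟨P, hPX, hP2, hPdep⟩ := hpair
    have hPF : P ⊆ F := hall P (hPX.trans hXE) hP2 hPdep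
    have h2 : 2 ≤ (X ∩ F).ncard := by
      rw [← hP2]; exact Set.ncard_le_ncard (subset_inter hPX hPF) (hXfin.subset inter_subset_left)
    have h4 : (X ∩ F).ncard ≤ 4 := by
      rw [← hX4]; exact Set.ncard_le_ncard inter_subset_left hXfin
    rcases Nat.lt_or_ge (X ∩ F).ncard 3 with hlt | hge
    · exact Or.inl (Or.inl ⟨hXE, hX4, by omega⟩)
    rcases Nat.lt_or_ge (X ∩ F).ncard 4 with hlt' | hge'
    · exact Or.inl (Or.inr ⟨hXE, hX4, by omega⟩)
    · exact Or.inr ⟨hXE, hX4, by omega⟩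
  have hc2 := ncard_inter_eq_le hEfin hF 4 2
  have hc3 := ncard_inter_eq_le hEfin hF 4 3
  have hc4 := ncard_inter_eq_le hEfin hF 4 4
  rw [hF4, hEF] at hc2 hc3 hc4
  rw [show (4 : ℕ) - 2 = 2 by norm_num, show (4 : ℕ).choose 2 = 6 by decide] at hc2
  rw [show (4 : ℕ) - 3 = 1 by norm_num, show (4 : ℕ).choose 3 = 4 by decide, Nat.choose_one_right] at hc3
  rw [show (4 : ℕ) - 4 = 0 by norm_num, show (4 : ℕ).choose 4 = 1 by decide, Nat.choose_zero_right] at hc4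
  have hfin : ∀ i, {X : Set α | X ⊆ M.E ∧ X.ncard = 4 ∧ (X ∩ F).ncard = i}.Finite :=
    fun _ => hEfin.finite_subsets.subset (fun X hX => hX.1)
  calc {X : Set α | X ⊆ M.E ∧ X.ncard = 4 ∧ M.Dep X}.ncard
      ≤ ({X : Set α | X ⊆ M.E ∧ X.ncard = 4 ∧ (X ∩ F).ncard = 2} ∪
          {X : Set α | X ⊆ M.E ∧ X.ncard = 4 ∧ (X ∩ F).ncard = 3} ∪
            {X : Set α | X ⊆ M.E ∧ X.ncard = 4 ∧ (X ∩ F).ncard = 4}).ncard :=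
        Set.ncard_le_ncard hsub (((hfin 2).union (hfin 3)).union (hfin 4))
    _ ≤ ({X : Set α | X ⊆ M.E ∧ X.ncard = 4 ∧ (X ∩ F).ncard = 2} ∪
          {X : Set α | X ⊆ M.E ∧ X.ncard = 4 ∧ (X ∩ F).ncard = 3}).ncard +
            {X : Set α | X ⊆ M.E ∧ X.ncard = 4 ∧ (X ∩ F).ncard = 4}.ncard := Set.ncard_union_le _ _
    _ ≤ {X : Set α | X ⊆ M.E ∧ X.ncard = 4 ∧ (X ∩ F).ncard = 2}.ncard +
          {X : Set α | X ⊆ M.E ∧ X.ncard = 4 ∧ (X ∩ F).ncard = 3}.ncard +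
            {X : Set α | X ⊆ M.E ∧ X.ncard = 4 ∧ (X ∩ F).ncard = 4}.ncard := by
        gcongr; exact Set.ncard_union_le _ _
    _ ≤ 6 * (M.E.ncard - 4).choose 2 + 4 * (M.E.ncard - 4) + 1 * 1 := by gcongr
    _ = 6 * (M.E.ncard - 4).choose 2 + 4 * (M.E.ncard - 4) + 1 := by ring

/-- **`D₂ = 4 ⇒ D₄ ≤ 4 · C(n − 2, 2)`** (`n ≥ 11`; no short circuits). -/
theorem ncard_dep_four_le_of_eq_four (M : Matroid α) [M.Finite] (hL : ∀ e ∈ M.E, ¬ M.IsLoop e)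
    (hK : ∀ e, ¬ M.IsColoop e) (hd : M.E.encard = M.eRank + ((4 : ℕ) : ℕ∞)) (hn : 11 ≤ M.E.ncard)
    (h4 : {P : Set α | P ⊆ M.E ∧ P.ncard = 2 ∧ M.Dep P}.ncard = 4) :
    {X : Set α | X ⊆ M.E ∧ X.ncard = 4 ∧ M.Dep X}.ncard ≤ 4 * (M.E.ncard - 2).choose 2 := by
  have hEfin := M.ground_finite
  have hsplit := ncard_dep_four_le_split_general M
  have hT0 : {C : Set α | C ⊆ M.E ∧ M.IsCircuit C ∧ C.ncard = 3}.ncard = 0 := by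
    rw [Set.ncard_eq_zero (hEfin.finite_subsets.subset (fun X hX => hX.1)),
      Set.eq_empty_iff_forall_notMem]
    intro C hC
    obtain ⟨-, hCc, hC3⟩ := hC
    exact not_isCircuit_of_four_le_ncard_dep_pairs M hL hK hd hn (by omega) hCc (by omega) (by omega)
  have hC0 : {C : Set α | C ⊆ M.E ∧ M.IsCircuit C ∧ C.ncard = 4}.ncard = 0 := by
    rw [Set.ncard_eq_zero (hEfin.finite_subsets.subset (fun X hX => hX.1)),
      Set.eq_empty_iff_forall_notMem]
    intro C hC
    obtain ⟨-, hCc, hC4⟩ := hC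
    exact not_isCircuit_of_four_le_ncard_dep_pairs M hL hK hd hn (by omega) hCc (by omega) (by omega)
  rw [h4, hT0, hC0] at hsplit
  omega

/-- **`D₂ ≤ 3 ⇒ D₄ ≤ 3 · C(n − 2, 2) + 20 · (n − 3) + 35`** (stage 1: the nullity-only circuit counts). -/
theorem ncard_dep_four_le_of_le_three (M : Matroid α) [M.Finite]
    (hd : M.E.encard = M.eRank + ((4 : ℕ) : ℕ∞))
    (h3 : {P : Set α | P ⊆ M.E ∧ P.ncard = 2 ∧ M.Dep P}.ncard ≤ 3) :
    {X : Set α | X ⊆ M.E ∧ X.ncard = 4 ∧ M.Dep X}.ncard ≤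
      3 * (M.E.ncard - 2).choose 2 + 20 * (M.E.ncard - 3) + 35 := by
  have hsplit := ncard_dep_four_le_split_general M
  have hT := ncard_triangles_le_twenty M hd
  have hC := ncard_fourCircuits_le_thirtyfive M hd
  have h1 : (M.E.ncard - 2).choose 2 * {P : Set α | P ⊆ M.E ∧ P.ncard = 2 ∧ M.Dep P}.ncard ≤
      (M.E.ncard - 2).choose 2 * 3 := Nat.mul_le_mul_left _ h3
  have h2 : (M.E.ncard - 3) * {C : Set α | C ⊆ M.E ∧ M.IsCircuit C ∧ C.ncard = 3}.ncard ≤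
      (M.E.ncard - 3) * 20 := Nat.mul_le_mul_left _ hT
  omega

end S1CFG

end PercRepro
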